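import Mathlib.CategoryTheory.Limits.Constructions.LimitsOfProductsAndEqualizers
import Mathlib.CategoryTheory.Limits.Constructions.EpiMono
import Mathlib.CategoryTheory.Limits.Preserves.Shapes.Terminal
import Literature.AnabelianGeometry.SemiGraphs.QuasiTemperoidsThmA4CechQuotient
import Literature.AnabelianGeometry.SemiGraphs.BTempCechToolkit
import Literature.AnabelianGeometry.SemiGraphs.BTempStructureProofs
import HarnessLib

/-!
# Semi-graphs of anabelioids, Appendix, Theorem A.4: the Čech extension `ψ^*` preserves finite limits

Mochizuki, *Semi-graphs of anabelioids*, Publ. RIMS **42** (2006) 221–322, Appendix, proof of Theorem A.4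
(manuscript pp. 85–86, PRIMS pp. 315–316) [cite: MochizukiSemiAnbd2006, Thm A.4 proof pp.85-86]: "The
fact that the resulting functor `ψ^* : T₂ → T₁` preserves … fibered products follows by a routine
argument from the fact that `φ^*` preserves countable colimits … and finite limits … `ψ^*` preserves
terminal objects".  PROOF-ONLY file (no definitions) doing that routine argument for the concrete Čech
extension `ψ^* = cechExt A₂ K` (`QuasiTemperoidsThmA4CechQuotient.lean`, `K : T₂[A₂] ⥤ B^temp(Π₁)`
preserving fibre products and binary products, `T₂` any category with binary products, fibre products and
a terminal object), ON POINTS of `B^temp(Π₁)`: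

* §1 the one-step relation `K(q₁) w ~ K(q₂) w` on `K(A₂ ⨯ X)` is an EQUIVALENCE relation (degeneracy,
  symmetry, and the composition `X₂ = X₁ ×_{X₀} X₁ → X₁`, which `K` preserves), so two points agree in
  `ψ^*(X)` iff one step relates them (`cechExtπ_eq_iff_rel`);
* §2 `(K(q₁), K(q₂))` is injective on points (`K` preserves `X₀ ⨯ X₀` and the mono `X₁ ↪ X₀ ⨯ X₀`);
* §3 TERMINAL: for `X` terminal `(q₁, q₂) : X₁ ≅ X₀ ⨯ X₀`, so all points of `K(A₂ ⨯ X) ≅ K(A₂)` are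
  identified and `ψ^*(X)` is the one-point object as soon as `K(A₂)` has a point;
* §4 FIBRE PRODUCTS: `ψ^*(X ×_Z Y) → ψ^*X ×_{ψ^*Z} ψ^*Y` is bijective — injectivity lifts the two
  witnesses to `K(P₁) = K(X₁) ×_{K(Z₁)} K(Y₁)` after matching them in `K(Z₁)` by §2; surjectivity moves a
  representative along `K(X₁) ≅ K(X₀) ×_{K(Z₀)} K(Z₁)` (along `q₁`) and pairs in
  `K(P₀) = K(X₀) ×_{K(Z₀)} K(Y₀)`;
* §5 terminal + fibre products ⇒ `PreservesFiniteLimits (cechExt A₂ K)` (`preservesFiniteLimits_cechExt`).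

Point bookkeeping of pullback cones / binary fans / terminal objects of `B^temp(Π)` via abc-iut-w4-d081's
`BTempCechToolkit.lean`.  Row A4-∃ (Čech route, parallel convention `A ⨯ X`) of the abc-iut cell's
`plan/L3/SUBDAG-SemiAnbd-Cor311.md`.  No side is taken on any disputed claim.
-/

open CategoryTheory CategoryTheory.Limits

namespace Literature.AnabelianGeometry.SemiGraphs

universe v₂ u u₂

section CechLimits

variable {T₂ : Type u₂} [Category.{v₂} T₂] [HasBinaryProducts T₂] [HasPullbacks T₂] (A₂ : T₂)
variable {G₁ : Type u} [Group G₁] [TopologicalSpace G₁] [IsTopologicalGroup G₁]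
variable (K : Over' A₂ ⥤ BTemp G₁)

open Literature.AlgebraicGeometry.Frobenioids.QuasiTemperoid.BTempConnected (hom_ρ hom_ext_apply)

/-! ### Point-level bookkeeping for `K` -/

omit [HasBinaryProducts T₂] [HasPullbacks T₂] [IsTopologicalGroup G₁] in
/-- `K` on a composite, evaluated at a point. [cite: MochizukiSemiAnbd2006, Thm A.4 proof pp.85-86] -/
theorem overFunctor_apply_of_comp_eq {B₁ B₂ B₃ : Over' A₂} {a : B₁ ⟶ B₂} {b : B₂ ⟶ B₃} {c : B₁ ⟶ B₃}
    (h : a ≫ b = c) (x : (K.obj B₁).obj.V) :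
    ((K.map b).hom.hom ((K.map a).hom.hom x) : (K.obj B₃).obj.V) = (K.map c).hom.hom x := by
  rw [← h, K.map_comp]
  rfl

omit [HasBinaryProducts T₂] [HasPullbacks T₂] [IsTopologicalGroup G₁] in
/-- `K(𝟙)` is the identity on points. [cite: MochizukiSemiAnbd2006, Thm A.4 proof pp.85-86] -/
theorem overFunctor_id_apply (B : Over' A₂) (x : (K.obj B).obj.V) :
    ((K.map (𝟙 B)).hom.hom x : (K.obj B).obj.V) = x := by
  rw [K.map_id]
  rfl

/-! ### The one-step relation `K(q₁) w ~ K(q₂) w` is an equivalence relation -/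

section Rel

variable [PreservesLimitsOfShape WalkingCospan K]

omit [HasPullbacks T₂] [IsTopologicalGroup G₁] [PreservesLimitsOfShape WalkingCospan K] in
/-- Reflexivity, via the degeneracy `δ`. [cite: MochizukiSemiAnbd2006, Thm A.4 proof pp.85-86] -/
theorem cechRel_refl (X : T₂) (u : (K.obj ((cechZero A₂).obj X)).obj.V) :
    BTemp.CoeqRel (K.map ((cechFst A₂).app X)) (K.map ((cechSnd A₂).app X)) u u :=
  ⟨(K.map (cechDiag A₂ X)).hom.hom u,
    by rw [overFunctor_apply_of_comp_eq A₂ K (cechDiag_fst A₂ X), overFunctor_id_apply],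
    by rw [overFunctor_apply_of_comp_eq A₂ K (cechDiag_snd A₂ X), overFunctor_id_apply]⟩

omit [HasPullbacks T₂] [IsTopologicalGroup G₁] [PreservesLimitsOfShape WalkingCospan K] in
/-- Symmetry, via the swap `σ`. [cite: MochizukiSemiAnbd2006, Thm A.4 proof pp.85-86] -/
theorem cechRel_symm (X : T₂) {u u' : (K.obj ((cechZero A₂).obj X)).obj.V}
    (h : BTemp.CoeqRel (K.map ((cechFst A₂).app X)) (K.map ((cechSnd A₂).app X)) u u') :
    BTemp.CoeqRel (K.map ((cechFst A₂).app X)) (K.map ((cechSnd A₂).app X)) u' u := by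
  obtain ⟨w, rfl, rfl⟩ := h
  exact ⟨(K.map (cechSwap A₂ X)).hom.hom w,
    by rw [overFunctor_apply_of_comp_eq A₂ K (cechSwap_fst A₂ X)],
    by rw [overFunctor_apply_of_comp_eq A₂ K (cechSwap_snd A₂ X)]⟩

omit [IsTopologicalGroup G₁] in
/-- Transitivity, via the composition `X₂ = X₁ ×_{X₀} X₁ → X₁` (uses: `K` preserves fibre products).
[cite: MochizukiSemiAnbd2006, Thm A.4 proof pp.85-86] -/
theorem cechRel_trans (X : T₂) {u u' u'' : (K.obj ((cechZero A₂).obj X)).obj.V}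
    (h : BTemp.CoeqRel (K.map ((cechFst A₂).app X)) (K.map ((cechSnd A₂).app X)) u u')
    (h' : BTemp.CoeqRel (K.map ((cechFst A₂).app X)) (K.map ((cechSnd A₂).app X)) u' u'') :
    BTemp.CoeqRel (K.map ((cechFst A₂).app X)) (K.map ((cechSnd A₂).app X)) u u'' := by
  obtain ⟨w, rfl, rfl⟩ := h
  obtain ⟨w', hw', rfl⟩ := h'
  have hc := isLimitPullbackConeMapOfIsLimit K (cechTwo_condition A₂ X) (cechTwoIsLimit A₂ X)
  obtain ⟨ω, hω₁, hω₂⟩ := BTemp.exists_point_of_isLimit_pullbackCone' hc w w' hw'.symm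
  change ((K.map (cechTwoFst A₂ X)).hom.hom ω : _) = w at hω₁
  change ((K.map (cechTwoSnd A₂ X)).hom.hom ω : _) = w' at hω₂
  refine ⟨(K.map (cechComp A₂ X)).hom.hom ω, ?_, ?_⟩
  · rw [overFunctor_apply_of_comp_eq A₂ K (cechComp_fst A₂ X), ← overFunctor_apply_of_comp_eq A₂ K rfl, hω₁]
  · rw [overFunctor_apply_of_comp_eq A₂ K (cechComp_snd A₂ X), ← overFunctor_apply_of_comp_eq A₂ K rfl, hω₂]

omit [IsTopologicalGroup G₁] in
/-- The one-step relation is an equivalence relation. [cite: MochizukiSemiAnbd2006, Thm A.4 proof pp.85-86] -/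
theorem cechRel_equivalence (X : T₂) :
    Equivalence (BTemp.CoeqRel (K.map ((cechFst A₂).app X)) (K.map ((cechSnd A₂).app X))) :=
  ⟨cechRel_refl A₂ K X, cechRel_symm A₂ K X, cechRel_trans A₂ K X⟩

/-- **Two points of `K(A₂ ⨯ X)` have the same image in `ψ^*(X)` iff ONE step relates them.**
[cite: MochizukiSemiAnbd2006, Thm A.4 proof pp.85-86] -/
theorem cechExtπ_eq_iff_rel (X : T₂) {u u' : (K.obj ((cechZero A₂).obj X)).obj.V} :
    ((cechExtπ A₂ K X).hom.hom u : ((cechExt A₂ K).obj X).obj.V) = (cechExtπ A₂ K X).hom.hom u' ↔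
      BTemp.CoeqRel (K.map ((cechFst A₂).app X)) (K.map ((cechSnd A₂).app X)) u u' :=
  (cechExtπ_eq_iff A₂ K X).trans (cechRel_equivalence A₂ K X).eqvGen_iff

end Rel

/-! ### Points of `K(X₁)` are determined by their two faces -/

section Faces

variable [PreservesLimitsOfShape WalkingCospan K] [PreservesLimitsOfShape (Discrete WalkingPair) K]

omit [HasPullbacks T₂] [IsTopologicalGroup G₁] in
/-- `(K(q₁), K(q₂))` is injective on points (uses: `K` preserves the product `X₀ ⨯ X₀` and monos).
[cite: MochizukiSemiAnbd2006, Thm A.4 proof pp.85-86] -/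
theorem cechOne_point_ext (X : T₂) {w w' : (K.obj ((cechOne A₂).obj X)).obj.V}
    (h₁ : ((K.map ((cechFst A₂).app X)).hom.hom w : (K.obj ((cechZero A₂).obj X)).obj.V) =
      (K.map ((cechFst A₂).app X)).hom.hom w')
    (h₂ : ((K.map ((cechSnd A₂).app X)).hom.hom w : (K.obj ((cechZero A₂).obj X)).obj.V) =
      (K.map ((cechSnd A₂).app X)).hom.hom w') : w = w' := by
  haveI := mono_cechPairing A₂ X
  haveI : K.PreservesMonomorphisms := preservesMonomorphisms_of_preservesLimitsOfShape K
  have hinj := (BTemp.mono_iff_injective (K.map (cechPairing A₂ X))).mp inferInstance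
  apply hinj
  apply BTemp.point_ext_of_isLimit_binaryFan
    (isLimitMapConeBinaryFanEquiv K _ _ (isLimitOfPreserves K (cechPairIsLimit A₂ X)))
  · change ((K.map (cechPairFst A₂ X)).hom.hom ((K.map (cechPairing A₂ X)).hom.hom w) : _) =
      (K.map (cechPairFst A₂ X)).hom.hom ((K.map (cechPairing A₂ X)).hom.hom w')
    rw [overFunctor_apply_of_comp_eq A₂ K (cechPairing_fst A₂ X),
      overFunctor_apply_of_comp_eq A₂ K (cechPairing_fst A₂ X)]
    exact h₁
  · change ((K.map (cechPairSnd A₂ X)).hom.hom ((K.map (cechPairing A₂ X)).hom.hom w) : _) =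
      (K.map (cechPairSnd A₂ X)).hom.hom ((K.map (cechPairing A₂ X)).hom.hom w')
    rw [overFunctor_apply_of_comp_eq A₂ K (cechPairing_snd A₂ X),
      overFunctor_apply_of_comp_eq A₂ K (cechPairing_snd A₂ X)]
    exact h₂

end Faces

/-! ### `ψ^*` preserves terminal objects -/

section Terminal

variable [PreservesLimitsOfShape WalkingCospan K] [PreservesLimitsOfShape (Discrete WalkingPair) K]

/-- **`ψ^*(X)` is terminal for `X` terminal**, provided `K(A₂)` has a point: all points of
`K(A₂ ⨯ X) ≅ K(A₂)` are identified because `(q₁, q₂) : X₁ ≅ X₀ ⨯ X₀` and `K` preserves this product.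
[cite: MochizukiSemiAnbd2006, Thm A.4 proof pp.85-86] -/
theorem nonempty_isTerminal_cechExt_obj {X : T₂} (hX : IsTerminal X)
    (hne : Nonempty (K.obj ⟨A₂, ⟨𝟙 A₂⟩⟩).obj.V) : Nonempty (IsTerminal ((cechExt A₂ K).obj X)) := by
  -- the binary fan `(q₁, q₂)` is a product in `T₂[A₂]`, and `K` preserves it
  have hfan : IsLimit (BinaryFan.mk ((cechFst A₂).app X) ((cechSnd A₂).app X)) :=
    isLimitOfReflects (admitsHomTo A₂).ι
      ((isLimitMapConeBinaryFanEquiv (admitsHomTo A₂).ι _ _).symm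
        (nonempty_isLimitBinaryFanCechOfIsTerminal A₂ hX).some)
  have hK := isLimitMapConeBinaryFanEquiv K _ _ (isLimitOfPreserves K hfan)
  -- every two points of `K(A₂ ⨯ X)` are identified in `ψ^*(X)`
  have hall : ∀ u u' : (K.obj ((cechZero A₂).obj X)).obj.V,
      ((cechExtπ A₂ K X).hom.hom u : ((cechExt A₂ K).obj X).obj.V) = (cechExtπ A₂ K X).hom.hom u' := by
    intro u u'
    rw [cechExtπ_eq_iff_rel]
    obtain ⟨w, hw₁, hw₂⟩ := BTemp.exists_point_of_isLimit_binaryFan' hK u u'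
    exact ⟨w, hw₁, hw₂⟩
  -- `K(A₂ ⨯ X) ≅ K(A₂)` has a point
  obtain ⟨a⟩ := hne
  let u₀ : (K.obj ((cechZero A₂).obj X)).obj.V :=
    (K.map (cechZeroIsoOfIsTerminal A₂ hX).inv).hom.hom a
  exact ⟨BTemp.isTerminal_of_unique _ ((cechExtπ A₂ K X).hom.hom u₀) fun z => by
    obtain ⟨u, rfl⟩ := cechExtπ_surjective A₂ K X z
    exact hall u u₀⟩

variable [HasTerminal T₂]

/-- **`ψ^*` preserves terminal objects** (given a point of `K(A₂)`).
[cite: MochizukiSemiAnbd2006, Thm A.4 proof pp.85-86] -/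
theorem preservesLimitsOfShape_pempty_cechExt (hne : Nonempty (K.obj ⟨A₂, ⟨𝟙 A₂⟩⟩).obj.V) :
    PreservesLimitsOfShape (Discrete.{0} PEmpty) (cechExt A₂ K) := by
  obtain ⟨h⟩ := nonempty_isTerminal_cechExt_obj A₂ K terminalIsTerminal hne
  haveI : PreservesLimit (Functor.empty.{0} T₂) (cechExt A₂ K) :=
    preservesLimit_of_preserves_limit_cone terminalIsTerminal
      ((isLimitMapConeEmptyConeEquiv (cechExt A₂ K) (⊤_ T₂)).symm h)
  exact preservesLimitsOfShape_pempty_of_preservesTerminal _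

end Terminal

/-! ### `ψ^*` preserves fibre products -/

section Pullbacks

variable [PreservesLimitsOfShape WalkingCospan K] [PreservesLimitsOfShape (Discrete WalkingPair) K]

variable {P X Y Z : T₂} {f : X ⟶ Z} {g : Y ⟶ Z} {π₁ : P ⟶ X} {π₂ : P ⟶ Y} {comm : π₁ ≫ f = π₂ ≫ g}
  (hP : IsLimit (PullbackCone.mk π₁ π₂ comm))

omit [HasPullbacks T₂] [IsTopologicalGroup G₁] [PreservesLimitsOfShape (Discrete WalkingPair) K] in
include hP in
/-- `K(P₀) ≅ K(X₀) ×_{K(Z₀)} K(Y₀)` on points: existence. [cite: MochizukiSemiAnbd2006, Thm A.4 proof pp.85-86] -/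
theorem cechZero_exists_point (x : (K.obj ((cechZero A₂).obj X)).obj.V) (y : (K.obj ((cechZero A₂).obj Y)).obj.V)
    (h : ((K.map ((cechZero A₂).map f)).hom.hom x : (K.obj ((cechZero A₂).obj Z)).obj.V) =
      (K.map ((cechZero A₂).map g)).hom.hom y) :
    ∃ p : (K.obj ((cechZero A₂).obj P)).obj.V,
      ((K.map ((cechZero A₂).map π₁)).hom.hom p : (K.obj ((cechZero A₂).obj X)).obj.V) = x ∧
      ((K.map ((cechZero A₂).map π₂)).hom.hom p : (K.obj ((cechZero A₂).obj Y)).obj.V) = y := by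
  have h₀ : IsLimit (PullbackCone.mk ((cechZero A₂).map π₁) ((cechZero A₂).map π₂)
      (by rw [← (cechZero A₂).map_comp, comm, (cechZero A₂).map_comp]) :
      PullbackCone ((cechZero A₂).map f) ((cechZero A₂).map g)) :=
    isLimitOfIsLimitPullbackConeMap (admitsHomTo A₂).ι _ (nonempty_isLimitPullbackConeProdMap A₂ hP).some
  exact BTemp.exists_point_of_isLimit_pullbackCone' (isLimitPullbackConeMapOfIsLimit K _ h₀) x y h

omit [HasPullbacks T₂] [IsTopologicalGroup G₁] [PreservesLimitsOfShape (Discrete WalkingPair) K] in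
include hP in
/-- `K(P₀) ≅ K(X₀) ×_{K(Z₀)} K(Y₀)` on points: uniqueness. [cite: MochizukiSemiAnbd2006, Thm A.4 proof pp.85-86] -/
theorem cechZero_point_ext {p p' : (K.obj ((cechZero A₂).obj P)).obj.V}
    (h₁ : ((K.map ((cechZero A₂).map π₁)).hom.hom p : (K.obj ((cechZero A₂).obj X)).obj.V) =
      (K.map ((cechZero A₂).map π₁)).hom.hom p')
    (h₂ : ((K.map ((cechZero A₂).map π₂)).hom.hom p : (K.obj ((cechZero A₂).obj Y)).obj.V) =
      (K.map ((cechZero A₂).map π₂)).hom.hom p') : p = p' := by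
  have h₀ : IsLimit (PullbackCone.mk ((cechZero A₂).map π₁) ((cechZero A₂).map π₂)
      (by rw [← (cechZero A₂).map_comp, comm, (cechZero A₂).map_comp]) :
      PullbackCone ((cechZero A₂).map f) ((cechZero A₂).map g)) :=
    isLimitOfIsLimitPullbackConeMap (admitsHomTo A₂).ι _ (nonempty_isLimitPullbackConeProdMap A₂ hP).some
  exact BTemp.point_ext_of_isLimit_pullbackCone (isLimitPullbackConeMapOfIsLimit K _ h₀) h₁ h₂

omit [HasPullbacks T₂] [IsTopologicalGroup G₁] [PreservesLimitsOfShape (Discrete WalkingPair) K] in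
include hP in
/-- `K(P₁) ≅ K(X₁) ×_{K(Z₁)} K(Y₁)` on points: existence. [cite: MochizukiSemiAnbd2006, Thm A.4 proof pp.85-86] -/
theorem cechOne_exists_point (x : (K.obj ((cechOne A₂).obj X)).obj.V) (y : (K.obj ((cechOne A₂).obj Y)).obj.V)
    (h : ((K.map ((cechOne A₂).map f)).hom.hom x : (K.obj ((cechOne A₂).obj Z)).obj.V) =
      (K.map ((cechOne A₂).map g)).hom.hom y) :
    ∃ p : (K.obj ((cechOne A₂).obj P)).obj.V,
      ((K.map ((cechOne A₂).map π₁)).hom.hom p : (K.obj ((cechOne A₂).obj X)).obj.V) = x ∧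
      ((K.map ((cechOne A₂).map π₂)).hom.hom p : (K.obj ((cechOne A₂).obj Y)).obj.V) = y := by
  have h₀ : IsLimit (PullbackCone.mk ((cechOne A₂).map π₁) ((cechOne A₂).map π₂)
      (by rw [← (cechOne A₂).map_comp, comm, (cechOne A₂).map_comp]) :
      PullbackCone ((cechOne A₂).map f) ((cechOne A₂).map g)) :=
    isLimitOfIsLimitPullbackConeMap (admitsHomTo A₂).ι _
      (nonempty_isLimitPullbackConeProdMap A₂ (nonempty_isLimitPullbackConeProdMap A₂ hP).some).some
  exact BTemp.exists_point_of_isLimit_pullbackCone' (isLimitPullbackConeMapOfIsLimit K _ h₀) x y h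

omit [HasPullbacks T₂] [IsTopologicalGroup G₁] [PreservesLimitsOfShape (Discrete WalkingPair) K] in
/-- `K(X₁) ≅ K(X₀) ×_{K(Z₀)} K(Z₁)` (along `q₁`) on points: existence.
[cite: MochizukiSemiAnbd2006, Thm A.4 proof pp.85-86] -/
theorem cechFst_exists_point (f : X ⟶ Z) (x : (K.obj ((cechZero A₂).obj X)).obj.V)
    (w : (K.obj ((cechOne A₂).obj Z)).obj.V)
    (h : ((K.map ((cechZero A₂).map f)).hom.hom x : (K.obj ((cechZero A₂).obj Z)).obj.V) =
      (K.map ((cechFst A₂).app Z)).hom.hom w) :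
    ∃ v : (K.obj ((cechOne A₂).obj X)).obj.V,
      ((K.map ((cechFst A₂).app X)).hom.hom v : (K.obj ((cechZero A₂).obj X)).obj.V) = x ∧
      ((K.map ((cechOne A₂).map f)).hom.hom v : (K.obj ((cechOne A₂).obj Z)).obj.V) = w := by
  have h₀ : IsLimit (PullbackCone.mk ((cechFst A₂).app X) ((cechOne A₂).map f)
      ((cechFst A₂).naturality f).symm :
      PullbackCone ((cechZero A₂).map f) ((cechFst A₂).app Z)) :=
    isLimitOfIsLimitPullbackConeMap (admitsHomTo A₂).ι _
      (nonempty_isLimitPullbackConeSndProdMap A₂ (prod.map (𝟙 A₂) f)).some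
  exact BTemp.exists_point_of_isLimit_pullbackCone' (isLimitPullbackConeMapOfIsLimit K _ h₀) x w h

omit [HasPullbacks T₂] [IsTopologicalGroup G₁] [PreservesLimitsOfShape WalkingCospan K]
  [PreservesLimitsOfShape (Discrete WalkingPair) K] in
/-- Naturality of the faces on points: `K(qᵢ^Z)(K(f₁) w) = K(f₀)(K(qᵢ^X) w)`.
[cite: MochizukiSemiAnbd2006, Thm A.4 proof pp.85-86] -/
theorem cechFace_natural_apply {q : cechOne A₂ ⟶ cechZero A₂} (f : X ⟶ Z)
    (w : (K.obj ((cechOne A₂).obj X)).obj.V) :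
    ((K.map (q.app Z)).hom.hom ((K.map ((cechOne A₂).map f)).hom.hom w) : (K.obj ((cechZero A₂).obj Z)).obj.V) =
      (K.map ((cechZero A₂).map f)).hom.hom ((K.map (q.app X)).hom.hom w) := by
  rw [overFunctor_apply_of_comp_eq A₂ K (q.naturality f), overFunctor_apply_of_comp_eq A₂ K rfl]

omit [HasPullbacks T₂] [PreservesLimitsOfShape WalkingCospan K] [PreservesLimitsOfShape (Discrete WalkingPair) K] in
/-- `ψ^*` on points: `ψ^*(h)(π_X u) = π_Y(K(A₂ ⨯ h) u)`. [cite: MochizukiSemiAnbd2006, Thm A.4 proof pp.85-86] -/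
theorem cechExt_map_apply {X Y : T₂} (h : X ⟶ Y) (u : (K.obj ((cechZero A₂).obj X)).obj.V) :
    (((cechExt A₂ K).map h).hom.hom ((cechExtπ A₂ K X).hom.hom u) : ((cechExt A₂ K).obj Y).obj.V) =
      (cechExtπ A₂ K Y).hom.hom ((K.map ((cechZero A₂).map h)).hom.hom u) := by
  have e := cechExtπ_map A₂ K h
  exact congrArg (fun χ : K.obj ((cechZero A₂).obj X) ⟶ (cechExt A₂ K).obj Y => (χ.hom.hom u : _)) e

include hP in
/-- **`ψ^*` carries the pullback `P = X ×_Z Y` to a pullback of `B^temp(Π₁)`** (checked on points: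
injectivity lifts the two witnesses to `K(P₁)` after matching them in `K(Z₁)` by the injectivity of
`(K(q₁), K(q₂))`; surjectivity moves a representative along `K(X₁) ≅ K(X₀) ×_{K(Z₀)} K(Z₁)` and
pairs in `K(P₀)`). [cite: MochizukiSemiAnbd2006, Thm A.4 proof pp.85-86] -/
theorem nonempty_isLimit_cechExt_pullbackCone :
    Nonempty (IsLimit (PullbackCone.mk ((cechExt A₂ K).map π₁) ((cechExt A₂ K).map π₂)
      (by rw [← (cechExt A₂ K).map_comp, comm, (cechExt A₂ K).map_comp]) :
      PullbackCone ((cechExt A₂ K).map f) ((cechExt A₂ K).map g))) := by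
  refine BTemp.isLimit_pullbackCone_of_bijective _ ?_ ?_
  swap
  · -- surjectivity
    intro s t hst
    obtain ⟨uX, rfl⟩ := cechExtπ_surjective A₂ K X s
    obtain ⟨uY, rfl⟩ := cechExtπ_surjective A₂ K Y t
    change (((cechExt A₂ K).map f).hom.hom ((cechExtπ A₂ K X).hom.hom uX) : ((cechExt A₂ K).obj Z).obj.V) =
      ((cechExt A₂ K).map g).hom.hom ((cechExtπ A₂ K Y).hom.hom uY) at hst
    rw [cechExt_map_apply, cechExt_map_apply, cechExtπ_eq_iff_rel] at hst
    obtain ⟨w, hw₁, hw₂⟩ := hst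
    obtain ⟨wX, hwX₁, hwX₂⟩ := cechFst_exists_point A₂ K f uX w hw₁.symm
    obtain ⟨uP, huP₁, huP₂⟩ := cechZero_exists_point A₂ K hP ((K.map ((cechSnd A₂).app X)).hom.hom wX) uY
      (by rw [← cechFace_natural_apply, hwX₂, hw₂])
    refine ⟨(cechExtπ A₂ K P).hom.hom uP, ?_, ?_⟩
    · change (((cechExt A₂ K).map π₁).hom.hom ((cechExtπ A₂ K P).hom.hom uP) : ((cechExt A₂ K).obj X).obj.V) =
        (cechExtπ A₂ K X).hom.hom uX
      rw [cechExt_map_apply, huP₁, cechExtπ_eq_iff_rel]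
      exact cechRel_symm A₂ K X ⟨wX, hwX₁, rfl⟩
    · change (((cechExt A₂ K).map π₂).hom.hom ((cechExtπ A₂ K P).hom.hom uP) : ((cechExt A₂ K).obj Y).obj.V) =
        (cechExtπ A₂ K Y).hom.hom uY
      rw [cechExt_map_apply, huP₂]
  · -- injectivity
    intro t t' h₁ h₂
    obtain ⟨u, rfl⟩ := cechExtπ_surjective A₂ K P t
    obtain ⟨u', rfl⟩ := cechExtπ_surjective A₂ K P t'
    change (((cechExt A₂ K).map π₁).hom.hom ((cechExtπ A₂ K P).hom.hom u) : ((cechExt A₂ K).obj X).obj.V) =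
      ((cechExt A₂ K).map π₁).hom.hom ((cechExtπ A₂ K P).hom.hom u') at h₁
    change (((cechExt A₂ K).map π₂).hom.hom ((cechExtπ A₂ K P).hom.hom u) : ((cechExt A₂ K).obj Y).obj.V) =
      ((cechExt A₂ K).map π₂).hom.hom ((cechExtπ A₂ K P).hom.hom u') at h₂
    rw [cechExt_map_apply, cechExt_map_apply, cechExtπ_eq_iff_rel] at h₁ h₂
    obtain ⟨wX, hwX₁, hwX₂⟩ := h₁
    obtain ⟨wY, hwY₁, hwY₂⟩ := h₂
    apply (cechExtπ_eq_iff_rel A₂ K P).mpr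
    -- the images of the witnesses in `K(Z₁)` agree
    have hz : ((K.map ((cechOne A₂).map f)).hom.hom wX : (K.obj ((cechOne A₂).obj Z)).obj.V) =
        (K.map ((cechOne A₂).map g)).hom.hom wY := by
      apply cechOne_point_ext A₂ K Z
      · rw [cechFace_natural_apply, cechFace_natural_apply, hwX₁, hwY₁,
          overFunctor_apply_of_comp_eq A₂ K rfl, overFunctor_apply_of_comp_eq A₂ K rfl,
          ← (cechZero A₂).map_comp, ← (cechZero A₂).map_comp, comm]
      · rw [cechFace_natural_apply, cechFace_natural_apply, hwX₂, hwY₂,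
          overFunctor_apply_of_comp_eq A₂ K rfl, overFunctor_apply_of_comp_eq A₂ K rfl,
          ← (cechZero A₂).map_comp, ← (cechZero A₂).map_comp, comm]
    obtain ⟨wP, hwP₁, hwP₂⟩ := cechOne_exists_point A₂ K hP wX wY hz
    refine ⟨wP, ?_, ?_⟩
    · apply cechZero_point_ext A₂ K hP
      · rw [← cechFace_natural_apply, hwP₁, hwX₁]
      · rw [← cechFace_natural_apply, hwP₂, hwY₁]
    · apply cechZero_point_ext A₂ K hP
      · rw [← cechFace_natural_apply, hwP₁, hwX₂]
      · rw [← cechFace_natural_apply, hwP₂, hwY₂]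

omit hP

/-- **`ψ^*` preserves fibre products.** [cite: MochizukiSemiAnbd2006, Thm A.4 proof pp.85-86] -/
theorem preservesLimitsOfShape_walkingCospan_cechExt :
    PreservesLimitsOfShape WalkingCospan (cechExt A₂ K) := by
  refine ⟨fun {D} => ?_⟩
  haveI : PreservesLimit (cospan (D.map WalkingCospan.Hom.inl) (D.map WalkingCospan.Hom.inr)) (cechExt A₂ K) := by
    obtain ⟨h⟩ := nonempty_isLimit_cechExt_pullbackCone A₂ K
      (pullbackIsPullback (D.map WalkingCospan.Hom.inl) (D.map WalkingCospan.Hom.inr))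
    exact preservesLimit_of_preserves_limit_cone
      (pullbackIsPullback (D.map WalkingCospan.Hom.inl) (D.map WalkingCospan.Hom.inr))
      ((isLimitMapConePullbackConeEquiv (cechExt A₂ K) pullback.condition).symm h)
  exact preservesLimit_of_iso_diagram (cechExt A₂ K) (diagramIsoCospan D).symm

end Pullbacks

/-! ### `ψ^*` preserves finite limits -/

/-- **`ψ^*` preserves finite limits** when `K` preserves fibre products and binary products and
`K(A₂)` has a point (terminal object + fibre products ⇒ all finite limits).
[cite: MochizukiSemiAnbd2006, Thm A.4 proof pp.85-86] -/
theorem preservesFiniteLimits_cechExt [HasTerminal T₂] [PreservesLimitsOfShape WalkingCospan K]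
    [PreservesLimitsOfShape (Discrete WalkingPair) K] (hne : Nonempty (K.obj ⟨A₂, ⟨𝟙 A₂⟩⟩).obj.V) :
    PreservesFiniteLimits (cechExt A₂ K) := by
  haveI := preservesLimitsOfShape_pempty_cechExt A₂ K hne
  haveI := preservesLimitsOfShape_walkingCospan_cechExt A₂ K
  exact preservesFiniteLimits_of_preservesTerminal_and_pullbacks _

end CechLimits

end Literature.AnabelianGeometry.SemiGraphs
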